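import Literature.MathematicalPhysics.QuantumFieldTheory.Balaban1983to89.B9Eq3105FamThreeLocCDiffCubeTails
import Literature.MathematicalPhysics.QuantumFieldTheory.Balaban1983to89.B9Eq3105FamThreeCommStepAdjAtDatum
import Literature.MathematicalPhysics.QuantumFieldTheory.Balaban1983to89.B9Cor36CutoffSecondDiff
import Literature.MathematicalPhysics.QuantumFieldTheory.Balaban1983to89.B9Cor36CinvCubeAtLocCfg

/-!
# `Balaban1983to89.B9Eq3105FamThreeLocCDiffCubeTailsGK` — FAMILY 3 OF (3.105), THE `C`-DIFFERENCE WORD: THE RESOLVENT–COMMUTATOR WORD `sS_□·G′_□K_χ` ON THE MEMBER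
# CARRIER (FILE 8b's displayed `hTK`) FROM CUBE-CARRIER DATA AT `Ṽ_□`, AND THE SPELLING CONVERSIONS OF THE DISPLAYED CUBE DATA — the free outer column cut-off of
# `K_χ = Δ′_□M_{χ_□} − M_{χ_□}Δ′_□`, the cube chain, FILE 8b's transfer; E3c's (3.33) rotation and member transfer of `G′_□K_χ` TAKEN BY NAME (lead g35 WORD FAMTHREE-6a;
# p38 g48 E3c `B9Eq3105FamThreeCommStepAdjAtDatum`: `commStepAdj_gauge_inv_eq`, `hasMajorant_conj_commStepAdj_member[_rate]` = F3-E3's `hGK □` — not restated here)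
# (sub-row G-B9-LETTERS, GAPS G-B9-05 family 3 (D2); programme FAMTHREE, F3-B3 FILE 8c)

statement-level skeleton of published theorems with citation tags; proofs where landed; nothing here is a claim about the Yang–Mills mass gap

THE PRINTED LOCUS (held `paper:balaban1985-cmp99-background-propagators`, journal page = PDF page + 388).  p. 415 l. 26–37; (3.88)–(3.89) p. 409 (the commutator
terms live in the transition region of `χ_□`); Cor. 3.6 p. 408; (3.31)–(3.33) pp. 395–396; (3.24) p. 394 (the stencil of `Δ′_{a,□}`); Thm 3.2 (3.48) p. 398; (3.19)–(3.21)
pp. 393–394; (3.25) p. 394.  [4] = `Balaban1984PropagatorsII` (2.46) p. 231, (2.51) p. 232, Lemma 2.1 (2.60)–(2.61) p. 234.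

WHAT THIS FILE CERTIFIES (kernel-checked; 0 `def`, 0 `def … : Prop`, 0 sorry)

§1 ★ `comm_mul_cutMulY_outer` — `K_χ(V)·M_{𝟙[NearC(7S_j∕2 + L^{j+1})]} = K_χ(V)` (`supp χ_□ ⊂ NearC(7S_j∕2)`, stencil reach `L^{j+1}`; p21's `deltaPrimeACubeY_apply_congr_stencil`);
   `outerCut_near` (`NearC(7S_j∕2 + L^{j+1}) ⊂ NearH`, p33 `nearH_of_nearC'`).
§2 ★★★ `hasMajorant_tk_at` — FILE 8b's displayed `hTK`: `conj(sS_□(V′)^ℝ)·conj((G′_□K_χ)(V′)^ℝ) ≺ κ_{SK}·ℓ(a)⁻⁴·e^{−(δ_K − α_cδ_K − αδ₀)d}` on the member carrier from the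
   cube-carrier majorants AT `Ṽ_□` of `sS_□` (weight `ℓ_□⁻⁴`) and `G′_□K_χ` (no weight): the cube chain (FILE 4 on the cube geometry), §1's column cut-off (sources
   near □), E3c's rotation, FILE 8b's `hasMajorant_conj_cubeWord_mul_cut_member`.
§3 (sub-namespace `…CubeTailsGK.CubeData`) the SPELLING conversions of the displayed cube data: `smul_restrictScalars_eq`, ★ `GpVK_eq_conj_smul` (p33 FILE 7b-A's
   `GpVK b i □ parSymY A` IS FILE 8b's `conj((e·G′_□(Ṽ_□))^ℝ)`, `e = ((η²:ℝ):ℂ)`), ★★ `hasMajorant_resolventCube_of_cinv` (p21 `cinv_cube_at_locCfg`'s block-carrier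
   majorant of `η⁻⁴X_□⁻¹(Ṽ)` — real power `ℓ_□^{−4}` — and its `Q′_□` homs give FILE 8b's `hSc` with `B_S = κ_Q²B`, by FILE 3's atom A2),
   ★ `isUnit_XCubeY_gauge` (FILE 7's `hXc □` from p21's `IsUnit X_□(Ṽ_□)`: r05 `XCubeY_cov` + `isUnit_conjY`).

HONEST SCOPE ∕ NOT CLAIMED.  Carrier-transfer and spelling bookkeeping over landed modules; the cube-carrier majorants AT `Ṽ_□` (`G′_□K_χ`: E3c's `commStepAdj_at_datum`
∃-package; `X_□⁻¹`, `Q′_□` homs: p21 `cinv_cube_at_locCfg`; `G′_□`: p33 `gp_cube_at_locCfg`), the cube ∕ member scale transfers and (2.61), the bi-contractive gauge are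
displayed; NO inequality of [B9] is proved here beyond them; NOT a node discharge; nothing continuum ∕ OS ∕ mass-gap ∕ Clay; YM mass gap NOT proved (Track A conditional
rung).  No `sorry`, no `axiom`, no `… : Prop` fact, no `instance`, no `notation`, no `def`.  NEW file; nothing landed is modified.  Cell `lit-balaban`, seat
`lit-balaban-p33` gen 104, 2026-08-29; `--supports stmt-QuantumFields-19200` as helper.  Net new unproved facts: 0.

RELATED IN THE TREE, NOT DUPLICATED (searched 2026-08-29: `rg 'tk_at|comm_mul_cutMulY_outer|resolventCube_of_cinv' Literature/` = ∅; the rotation `commStepAdj_gauge_inv_eq`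
and the member transfer `hasMajorant_conj_commStepAdj_member` of `G′_□K_χ` are E3c's — USED BY NAME, not restated): p38 E3c `B9Eq3105FamThreeCommStepAdjAtDatum`,
p38 `B9Eq3105FamThreeLocDiffGRight` (inner column cut `conj_GK_eq_mul_mulOp_colCut`), FILE 8b `B9Eq3105FamThreeLocCDiffCubeTails`, FILE 3 `…Atoms`, p21
`B9Cor36CinvCubeAtLocCfg`, p33 `B9Cor36GpCubeExtAtV` (`GpVK`).
-/

noncomputable section

namespace Literature.MathematicalPhysics.QuantumFieldTheory.Balaban1983to89.B9Eq3105FamThreeLocCDiffCubeTailsGK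

open NormedSpace Complex
open B6RandomWalk (HasMajorant hasMajorant_mono Ineq261 c1_nonneg Triangle254)
open B9Thm34Ext (toB6)
open B9Thm37Sum (mulOp mulOp_apply)
open B9Ineq347 (ScaleTransfer)
open B9Eq352DivFormLetters (conj)
open B9Eq360DeltaPrimeACubeY (blkCubeY)
open B6KLevelCensusIndexV1 (KIdx kGeo)
open B6Cover236MultiLevelBlocks (cubes)
open B6GlobalChartV1 (PV boxEquiv)
open B6Geom246MultiLevelBox (blkOf)
open B6Ineq2142KLevelV1 (β)
open B9GeoNormsKLevelV1 (geo9K)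
open B9GeoLemma21KLevelV1 (geo9K_len_pos)
open B9CubeGeometryInputs (geoCK geoCK_len_pos geoCK_dist_axioms)
open B9CubeLettersOpsL0 (GpCubeY deltaPrimeACubeY)
open B9CubeLettersBondOpsL0 (QpCubeY QpsCubeY XinvCubeY BlkCubeY)
open B9CubeSequence408 (NearH)
open B9Eq39Adjoint (R)
open B9Thm37CubeCoverCommutators (cutMulY cutMulY_apply stencilY)
open B9Thm39CinvTorusRegular (conj_cutMulY)
open B9Eq310Hermitian (norm_R_le norm_R_inv_le)
open B9Cor36CubeCutoffs (SC NearC chiY nearC_of_chiY_ne_zero one_le_SC)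
open B9Cor36CubeTwinsGeometry (bS one_le_bS eight_mul_bS_le_SC)
open B9Cor36CutoffSecondDiff (nearH_of_nearC')
open B9Cor36GpCubeLocLetter (conjY_mul_conjY_inv deltaPrimeACubeY_apply_congr_stencil)
open B9ThmDCommutatorStep (nearC_of_mem_stencilY')
open B9Eq3105FamTwoCore (geo9K_axioms)
open B9Eq3105FamThreeCommStepAdjAtDatum (commStepAdj_gauge_inv_eq)
open B9Eq3105FamThreeLocCDiffChains (mul_decay_majorant_blk)
open B9Eq3105FamThreeLocCDiffCubeTails (hasMajorant_conj_cubeWord_mul_cut_member smul_resolventWordCube_gauge_inv_eq)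
open B9Ineq366CPrime (scaleTransfer_one)
open Node00 (SiteY BlkY IBondY CfgY GaugeY SiteParY toKT conjY gSiteY gaugeY parSymY etaS parSymY_isGaugeLawS)

variable {d ℓ : ℕ} {hd : 1 ≤ d + 1} {hL : Odd (ℓ + 1) ∧ 1 < ℓ + 1} {b₀ b₁ : ℝ}
variable {𝔸 : Type} [NormedRing 𝔸] [NormedAlgebra ℂ 𝔸] [CompleteSpace 𝔸]
variable {ι : Type} [Fintype ι]
variable (i : KIdx d ℓ hd hL b₀ b₁) (c : ↥(cubes (toKT i).D.toDomains)) (b : Module.Basis ι ℝ 𝔸)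

/-! ## §1  The columns of `K_χ = Δ′_□M_{χ_□} − M_{χ_□}Δ′_□` lie within `NearC(7S_j∕2 + L^{j+1})` -/

section Columns

open Classical in
/-- ★ **THE OUTER COLUMN CUT-OFF OF `K_χ(V) = Δ′_□(V)M_{χ_□} − M_{χ_□}Δ′_□(V)` IS FREE**: `K_χ·M_{𝟙[NearC(7S_j∕2 + L^{j+1})]} = K_χ` — `supp χ_□ ⊂ NearC(7S_j∕2)` and the
stencil of `Δ′_□` has reach `L^{j+1}`. [cite: Balaban1985BackgroundPropagators, (3.88) p.409, (3.24) p.394, p.408] -/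
theorem comm_mul_cutMulY_outer (par : SiteParY 𝔸 i) (V : CfgY 𝔸 i) :
    (deltaPrimeACubeY i c par V * cutMulY (𝔸 := 𝔸) (chiY i c) - cutMulY (𝔸 := 𝔸) (chiY i c) * deltaPrimeACubeY i c par V) *
        cutMulY (𝔸 := 𝔸) (fun w : SiteY i => if NearC i c (7 * SC i c / 2 + (bS i c : ℤ)) w.1 then (1 : ℝ) else 0) =
      deltaPrimeACubeY i c par V * cutMulY (𝔸 := 𝔸) (chiY i c) - cutMulY (𝔸 := 𝔸) (chiY i c) * deltaPrimeACubeY i c par V := by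
  set f : SiteY i → ℝ := fun w => if NearC i c (7 * SC i c / 2 + (bS i c : ℤ)) w.1 then (1 : ℝ) else 0 with hf
  have hb1 : (1 : ℤ) ≤ (bS i c : ℤ) := by exact_mod_cast one_le_bS i c
  -- `χ_□·(fX) = χ_□·X` pointwise
  have hχf : ∀ (X : SiteY i → 𝔸) (w : SiteY i), cutMulY (𝔸 := 𝔸) (chiY i c) (cutMulY (𝔸 := 𝔸) f X) w = cutMulY (𝔸 := 𝔸) (chiY i c) X w := fun X w => by
    rw [cutMulY_apply, cutMulY_apply, cutMulY_apply]
    by_cases hw : chiY i c w = 0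
    · rw [hw, Complex.ofReal_zero, zero_smul, zero_smul]
    · have hn : NearC i c (7 * SC i c / 2 + (bS i c : ℤ)) w.1 := (nearC_of_chiY_ne_zero i c hw).mono i c (by linarith)
      rw [hf]; dsimp only; rw [if_pos hn, Complex.ofReal_one, one_smul]
  refine LinearMap.ext fun X => funext fun z => ?_
  rw [Module.End.mul_apply, LinearMap.sub_apply, LinearMap.sub_apply, Pi.sub_apply, Pi.sub_apply, Module.End.mul_apply, Module.End.mul_apply,
    Module.End.mul_apply, Module.End.mul_apply]
  congr 1
  · exact congrFun (congrArg (deltaPrimeACubeY i c par V) (funext (hχf X))) z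
  · rw [cutMulY_apply, cutMulY_apply]
    by_cases hz : chiY i c z = 0
    · rw [hz, Complex.ofReal_zero, zero_smul, zero_smul]
    · have hzn : NearC i c (7 * SC i c / 2) z.1 := nearC_of_chiY_ne_zero i c hz
      have h8 := eight_mul_bS_le_SC i c
      have hag : ∀ w ∈ stencilY i z, cutMulY (𝔸 := 𝔸) f X w = X w := fun w hw => by
        have hwn : NearC i c (7 * SC i c / 2 + (bS i c : ℤ)) w.1 := nearC_of_mem_stencilY' i c (by omega) hzn hw
        rw [cutMulY_apply, hf]; dsimp only; rw [if_pos hwn, Complex.ofReal_one, one_smul]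
      rw [deltaPrimeACubeY_apply_congr_stencil i c par V z hag]

open Classical in
/-- its support is a near window: `NearC(7S_j∕2 + L^{j+1}) ⊂ NearH` (`8L^{j+1} ≤ S_j`). [cite: Balaban1985BackgroundPropagators, p.408] -/
theorem outerCut_near : (∀ z : SiteY i, |(if NearC i c (7 * SC i c / 2 + (bS i c : ℤ)) z.1 then (1 : ℝ) else 0)| ≤ 1) ∧
    (∀ z : SiteY i, (if NearC i c (7 * SC i c / 2 + (bS i c : ℤ)) z.1 then (1 : ℝ) else 0) ≠ 0 → NearH c z.1) := by
  refine ⟨fun z => by split_ifs <;> simp, fun z hz => ?_⟩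
  by_cases h : NearC i c (7 * SC i c / 2 + (bS i c : ℤ)) z.1
  · have h8 := eight_mul_bS_le_SC i c
    exact nearH_of_nearC' i c (by omega) h
  · exact absurd (by rw [if_neg h]) hz

end Columns

/-! ## §2  FILE 8b's `hTK` from cube-carrier data at `Ṽ_□` (E3's `hGK □` itself: E3c `hasMajorant_conj_commStepAdj_member_rate`, BY NAME) -/

section Transfer

variable [Fintype (geo9K i).Site] {Rr : ℝ} {H : Prop} {Rr' : ℝ} {Hp : Prop}

open Classical in
set_option maxHeartbeats 3200000 in
/-- ★★★ **FILE 8b's displayed `hTK`**: `conj(sS_□(V′)^ℝ)·conj((G′_□K_χ)(V′)^ℝ) ≺ κ_{SK}·ℓ(a)⁻⁴·e^{−rd}` on the member carrier from the cube-carrier majorants AT `Ṽ_□` of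
`sS_□` (weight `ℓ_□⁻⁴`) and `G′_□K_χ` (no weight): the cube chain ([4] (2.61) on the cube geometry), the free outer column cut-off of `K_χ` (§1: sources near □), and
FILE 8b's `hasMajorant_conj_cubeWord_mul_cut_member`.
[cite: Balaban1985BackgroundPropagators, p.415 l.26–37, (3.88)–(3.89) p.409, Thm 3.2 (3.48) p.398, Cor. 3.6 p.408, (3.33) p.396; Balaban1984PropagatorsII, (2.51) p.232, (2.46) p.231, Lemma 2.1 (2.60)–(2.61) p.234] -/
theorem hasMajorant_tk_at {M₂ : ℝ} (hM₂ : 0 ≤ M₂) (hrepr : ∀ (v : 𝔸) (j : ι), |b.repr v j| ≤ M₂ * ‖v‖)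
    (u : GaugeY 𝔸 i) (hu : ∀ x, ‖((u x : 𝔸ˣ) : 𝔸)‖ ≤ 1 ∧ ‖(((u x)⁻¹ : 𝔸ˣ) : 𝔸)‖ ≤ 1) (V : CfgY 𝔸 i)
    (ιB : BlkY i → IBondY i) (hι : ∀ s, β i.hN i.D i.hk (ιB s) = s) (σ : ℂ)
    (dBK : ℕ) {BS δS θK δK βK αc Cc : ℝ} (hBS : 0 ≤ BS) (hθK : 0 ≤ θK) (hδK : 0 ≤ δK) (hbudK : δK + (0 + βK) * δS ≤ δS)
    (h261K : Ineq261 dBK (toB6 (geoCK i c) Rr H) δS βK)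
    (hCc : 0 ≤ Cc) (hrc : 0 ≤ δK - αc * δK) (hSTc : ScaleTransfer (geoCK i c) δK αc Cc (fun a => ((geoCK i c).len a ^ 4)⁻¹))
    (hSc : HasMajorant (g := toB6 (geoCK i c) Rr H) (fun p : SiteY i × ι => blkCubeY i c p.1)
      (conj b ((σ • (QpsCubeY i c (parSymY i) V ∘ₗ XinvCubeY i c (parSymY i) V ∘ₗ QpCubeY i c (parSymY i) V)).restrictScalars ℝ))
      (fun a s => BS * ((geoCK i c).len a ^ 4)⁻¹ * Real.exp (-(δS * (geoCK i c).dist a s))))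
    (hGKc : HasMajorant (g := toB6 (geoCK i c) Rr H) (fun p : SiteY i × ι => blkCubeY i c p.1)
      (conj b (((GpCubeY i c (parSymY i) V *
          (deltaPrimeACubeY i c (parSymY i) V * cutMulY (𝔸 := 𝔸) (chiY i c) - cutMulY (𝔸 := 𝔸) (chiY i c) * deltaPrimeACubeY i c (parSymY i) V)).restrictScalars ℝ :
        Module.End ℝ (SiteY i → 𝔸))))
      (fun a s => θK * Real.exp (-(δK * (geoCK i c).dist a s))))
    {δ₀ α C4 : ℝ} (hST4 : ScaleTransfer (geo9K i) δ₀ α C4 (fun a => ((geo9K i).len a ^ 4)⁻¹)) :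
    HasMajorant (g := toB6 (geo9K i) Rr' Hp) (fun p : SiteY i × ι => ιB (blkOf i.D.toDomains p.1))
      (conj b ((σ • (QpsCubeY i c (parSymY i) (gaugeY i u⁻¹ V) ∘ₗ XinvCubeY i c (parSymY i) (gaugeY i u⁻¹ V) ∘ₗ
          QpCubeY i c (parSymY i) (gaugeY i u⁻¹ V))).restrictScalars ℝ) *
        conj b (((GpCubeY i c (parSymY i) (gaugeY i u⁻¹ V) *
          (deltaPrimeACubeY i c (parSymY i) (gaugeY i u⁻¹ V) * cutMulY (𝔸 := 𝔸) (chiY i c) -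
            cutMulY (𝔸 := 𝔸) (chiY i c) * deltaPrimeACubeY i c (parSymY i) (gaugeY i u⁻¹ V))).restrictScalars ℝ : Module.End ℝ (SiteY i → 𝔸))))
      (fun a a' => ((M₂ * ∑ j, ‖b j‖) ^ 2 * ((BS * θK * 1 * B6.c1 dBK δS βK) * Cc) * C4) * ((geo9K i).len a ^ 4)⁻¹ *
        Real.exp (-((δK - αc * δK - α * δ₀) * (geo9K i).dist a a'))) := by
  obtain ⟨hdnnC, htriC, -, -⟩ := geoCK_dist_axioms i c Rr H
  set V' : CfgY 𝔸 i := gaugeY i u⁻¹ V with hV'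
  set f : SiteY i → ℝ := fun w => if NearC i c (7 * SC i c / 2 + (bS i c : ℤ)) w.1 then (1 : ℝ) else 0 with hf
  set Sσ : (SiteY i → 𝔸) →ₗ[ℂ] (SiteY i → 𝔸) := σ • (QpsCubeY i c (parSymY i) V ∘ₗ XinvCubeY i c (parSymY i) V ∘ₗ QpCubeY i c (parSymY i) V) with hSσ
  set GK : (SiteY i → 𝔸) →ₗ[ℂ] (SiteY i → 𝔸) := GpCubeY i c (parSymY i) V *
    (deltaPrimeACubeY i c (parSymY i) V * cutMulY (𝔸 := 𝔸) (chiY i c) - cutMulY (𝔸 := 𝔸) (chiY i c) * deltaPrimeACubeY i c (parSymY i) V) with hGK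
  set Sσ' : (SiteY i → 𝔸) →ₗ[ℂ] (SiteY i → 𝔸) :=
    σ • (QpsCubeY i c (parSymY i) V' ∘ₗ XinvCubeY i c (parSymY i) V' ∘ₗ QpCubeY i c (parSymY i) V') with hSσ'
  set GK' : (SiteY i → 𝔸) →ₗ[ℂ] (SiteY i → 𝔸) := GpCubeY i c (parSymY i) V' *
    (deltaPrimeACubeY i c (parSymY i) V' * cutMulY (𝔸 := 𝔸) (chiY i c) - cutMulY (𝔸 := 𝔸) (chiY i c) * deltaPrimeACubeY i c (parSymY i) V') with hGK'
  -- the operator as ONE cube word with the free outer column cut-off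
  have hrotS : Sσ' = conjY (gSiteY i u)⁻¹ * Sσ * conjY (gSiteY i u) := by rw [hSσ', hSσ, hV']; exact smul_resolventWordCube_gauge_inv_eq i c σ u V
  have hrotK : GK' = conjY (gSiteY i u)⁻¹ * GK * conjY (gSiteY i u) := by
    rw [hGK', hGK, hV']; exact commStepAdj_gauge_inv_eq i c (parSymY_isGaugeLawS i) u V
  have hrot : Sσ' * GK' = conjY (gSiteY i u)⁻¹ * (Sσ * GK) * conjY (gSiteY i u) := by
    rw [hrotS, hrotK]
    calc conjY (gSiteY i u)⁻¹ * Sσ * conjY (gSiteY i u) * (conjY (gSiteY i u)⁻¹ * GK * conjY (gSiteY i u))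
        = conjY (gSiteY i u)⁻¹ * Sσ * (conjY (gSiteY i u) * conjY (gSiteY i u)⁻¹) * GK * conjY (gSiteY i u) := by simp only [mul_assoc]
      _ = _ := by rw [conjY_mul_conjY_inv i (gSiteY i u), mul_one]; simp only [mul_assoc]
  have hcol : GK' = GK' * cutMulY (𝔸 := 𝔸) f := by
    rw [hGK', mul_assoc, comm_mul_cutMulY_outer i c (parSymY i) V']
  have hop : conj b (Sσ'.restrictScalars ℝ) * conj b (GK'.restrictScalars ℝ) = conj b ((Sσ' * GK').restrictScalars ℝ) * mulOp (fun p : SiteY i × ι => f p.1) := by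
    rw [← conj_cutMulY b f, ← B9Eq352DivFormLetters.conj_mul, ← B9Eq352DivFormLetters.conj_mul]
    refine congrArg (conj b) (LinearMap.ext fun Λ => ?_)
    conv_lhs => rw [hcol]
    rfl
  rw [hop]
  -- the cube chain `sS_□·(G′_□K_χ)` at `Ṽ_□`
  have hGKc' : HasMajorant (g := toB6 (geoCK i c) Rr H) (fun p : SiteY i × ι => blkCubeY i c p.1) (conj b (GK.restrictScalars ℝ))
      (fun a s => θK * (fun _ : BlkCubeY i c => (1 : ℝ)) a * Real.exp (-(δK * (geoCK i c).dist a s))) :=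
    hasMajorant_mono (g := toB6 (geoCK i c) Rr H) _ hGKc fun a s => le_of_eq (by rw [mul_one])
  have hW := mul_decay_majorant_blk (Rg := Rr) (Hg := H) (fun p : SiteY i × ι => blkCubeY i c p.1) dBK (fun a => ((geoCK i c).len a ^ 4)⁻¹)
    (fun _ : BlkCubeY i c => (1 : ℝ)) hBS hθK zero_le_one (fun a => inv_nonneg.2 (pow_nonneg (geoCK_len_pos i c a).le _)) (fun _ => zero_le_one) hδK hbudK
    hdnnC htriC (scaleTransfer_one (δ₀ := δS) (α := 0) (by simp) hdnnC) h261K hSc hGKc'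
  have hW' : HasMajorant (g := toB6 (geoCK i c) Rr H) (fun p : SiteY i × ι => blkCubeY i c p.1) (conj b ((Sσ * GK).restrictScalars ℝ))
      (fun a s => (BS * θK * 1 * B6.c1 dBK δS βK) * ((geoCK i c).len a ^ 4)⁻¹ * Real.exp (-(δK * (geoCK i c).dist a s))) := by
    rw [show ((Sσ * GK).restrictScalars ℝ : Module.End ℝ (SiteY i → 𝔸)) = Sσ.restrictScalars ℝ * GK.restrictScalars ℝ from LinearMap.ext fun _ => rfl,
      B9Eq352DivFormLetters.conj_mul]
    exact hasMajorant_mono (g := toB6 (geoCK i c) Rr H) _ hW fun a s => le_of_eq (by ring)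
  have hc1 : 0 ≤ B6.c1 dBK δS βK := c1_nonneg _ _ _
  exact hasMajorant_conj_cubeWord_mul_cut_member i c b (Rr := Rr) (H := H) (Rr' := Rr') (Hp := Hp) hM₂ hrepr u hu ιB hι (Sσ * GK) (Sσ' * GK') hrot f
    (outerCut_near i c).1 (outerCut_near i c).2 (by positivity : 0 ≤ BS * θK * 1 * B6.c1 dBK δS βK) hCc hrc hSTc hW' hST4

end Transfer

end Literature.MathematicalPhysics.QuantumFieldTheory.Balaban1983to89.B9Eq3105FamThreeLocCDiffCubeTailsGK



namespace Literature.MathematicalPhysics.QuantumFieldTheory.Balaban1983to89.B9Eq3105FamThreeLocCDiffCubeTailsGK.CubeData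

open NormedSpace Complex
open B6RandomWalk (HasMajorant hasMajorant_mono)
open B6RandomWalkHom (HasMajorantHom)
open B9Thm34Ext (toB6)
open B9Eq352DivFormLetters (conj)
open B9Eq376POneLetters (conjHom)
open B9Eq360DeltaPrimeACubeY (blkCubeY)
open B6KLevelCensusIndexV1 (KIdx kGeo)
open B6Cover236MultiLevelBlocks (cubes)
open B9CubeGeometryInputs (geoCK geoCK_len_pos)
open B9CubeLettersOpsL0 (GpCubeY)
open B9CubeLettersBondOpsL0 (QpCubeY QpsCubeY XCubeY XinvCubeY BlkCubeY)
open B9Cor36CubeCutoffs (locCfgY)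
open B9Cor36GpCubeExtAtV (GpVK)
open B9Eq360DeltaPrimeAY (AfldY)
open B9Eq3105FamThreeLocCDiffAtoms (hasMajorant_conj_resolventWord_cube)
open B9CubeLettersCovarianceL0 (XCubeY_cov gBlkCubeY)
open Node00 (SiteY CfgY GaugeY toKT conjY gaugeY parSymY parSymY_isGaugeLawS isUnit_conjY)

variable {d ℓ : ℕ} {hd : 1 ≤ d + 1} {hL : Odd (ℓ + 1) ∧ 1 < ℓ + 1} {b₀ b₁ : ℝ}
variable {𝔸 : Type} [NormedRing 𝔸] [NormedAlgebra ℂ 𝔸] [CompleteSpace 𝔸]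
variable {ι : Type} [Fintype ι]
variable (i : KIdx d ℓ hd hL b₀ b₁) (c : ↥(cubes (toKT i).D.toDomains)) (b : Module.Basis ι ℝ 𝔸) {Rr : ℝ} {H : Prop}

omit [CompleteSpace 𝔸] in
/-- a real scalar on a ℂ-linear site operator, two spellings: `(r • X)^ℝ`-outside vs `((r : ℂ) • X)^ℝ`. [cite: Balaban1984PropagatorsII, (2.51) p.232, bookkeeping] -/
theorem smul_restrictScalars_eq (r : ℝ) (X : (SiteY i → 𝔸) →ₗ[ℂ] (SiteY i → 𝔸)) :
    (r • X.restrictScalars ℝ : Module.End ℝ (SiteY i → 𝔸)) = (((r : ℝ) : ℂ) • X).restrictScalars ℝ :=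
  LinearMap.ext fun Λ => by
    simp only [LinearMap.smul_apply, LinearMap.restrictScalars_apply]
    exact (algebraMap_smul ℂ r (X Λ)).symm

/-- ★ p33's cube letter `GpVK` (FILE 7b-A) in FILE 8b's spelling: `GpVK b i □ parSymY A = conj b((((η²:ℝ):ℂ)·G′_□(Ṽ_□))^ℝ)`.
[cite: Balaban1985BackgroundPropagators, p.409 l.1–5, (3.25) p.394, Cor. 3.6 p.408] -/
theorem GpVK_eq_conj_smul (A : AfldY 𝔸 i) :
    GpVK b i c (parSymY i) A = conj b ((((((kGeo i).eta ^ 2 : ℝ)) : ℂ) • GpCubeY i c (parSymY i) (locCfgY i c (kGeo i).eta A)).restrictScalars ℝ) := by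
  unfold GpVK
  rw [smul_restrictScalars_eq]

/-- ★★ **FILE 8b∕8c's displayed `hSc` FROM p21's `cinv_cube_at_locCfg` DATA**: the block-carrier majorant of `conj b(η⁻⁴X_□⁻¹(Ṽ)^ℝ)` (kernel `B·ℓ_□^{−4}·e^{−δd_□}`, real
power) and the cube `Q′_□` homs (`κ_Q` on the diagonal) give, by FILE 3's atom A2, `conj b((((η⁻⁴:ℝ):ℂ)·Q′*_□X_□⁻¹Q′_□(Ṽ))^ℝ) ≺ (κ_Q²B)·(ℓ_□(a)⁴)⁻¹·e^{−δd_□}` on the cube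
SITE carrier. [cite: Balaban1985BackgroundPropagators, Thm 3.2 (3.48) p.398, (3.19)–(3.21) pp.393–394, Cor. 3.6 p.408; Balaban1984PropagatorsII, (2.51)–(2.55) p.232] -/
theorem hasMajorant_resolventCube_of_cinv (V : CfgY 𝔸 i) (s : ℝ) {κQ B δ : ℝ} (hκQ : 0 ≤ κQ) (hB : 0 ≤ B)
    (hQ : HasMajorantHom (g := toB6 (geoCK i c) Rr H) (fun p : SiteY i × ι => blkCubeY i c p.1) (fun q : BlkCubeY i c × ι => q.1)
      (conjHom b ((QpCubeY i c (parSymY i) V).restrictScalars ℝ)) (fun a a' : BlkCubeY i c => if a = a' then κQ else 0))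
    (hQs : HasMajorantHom (g := toB6 (geoCK i c) Rr H) (fun q : BlkCubeY i c × ι => q.1) (fun p : SiteY i × ι => blkCubeY i c p.1)
      (conjHom b ((QpsCubeY i c (parSymY i) V).restrictScalars ℝ)) (fun a a' : BlkCubeY i c => if a = a' then κQ else 0))
    (hC : HasMajorant (g := toB6 (geoCK i c) Rr H) (fun q : BlkCubeY i c × ι => q.1) (conj b (s • (XinvCubeY i c (parSymY i) V).restrictScalars ℝ))
      (fun a a' => B * (geoCK i c).len a ^ (-(4 : ℝ)) * Real.exp (-(δ * (geoCK i c).dist a a')))) :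
    HasMajorant (g := toB6 (geoCK i c) Rr H) (fun p : SiteY i × ι => blkCubeY i c p.1)
      (conj b ((((s : ℝ) : ℂ) • (QpsCubeY i c (parSymY i) V ∘ₗ XinvCubeY i c (parSymY i) V ∘ₗ QpCubeY i c (parSymY i) V)).restrictScalars ℝ))
      (fun a a' => (κQ ^ 2 * B) * ((geoCK i c).len a ^ 4)⁻¹ * Real.exp (-(δ * (geoCK i c).dist a a'))) := by
  have hK : ∀ a a' : BlkCubeY i c, 0 ≤ B * (geoCK i c).len a ^ (-(4 : ℝ)) * Real.exp (-(δ * (geoCK i c).dist a a')) := fun a a' =>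
    mul_nonneg (mul_nonneg hB (Real.rpow_nonneg (geoCK_len_pos i c a).le _)) (Real.exp_nonneg _)
  have h := hasMajorant_conj_resolventWord_cube i b c (parSymY i) V (Rr := Rr) (Hp := H) s hκQ hK hQ hQs hC
  rw [show (s • (QpsCubeY i c (parSymY i) V ∘ₗ XinvCubeY i c (parSymY i) V ∘ₗ QpCubeY i c (parSymY i) V) : (SiteY i → 𝔸) →ₗ[ℂ] (SiteY i → 𝔸)) =
      (((s : ℝ) : ℂ)) • (QpsCubeY i c (parSymY i) V ∘ₗ XinvCubeY i c (parSymY i) V ∘ₗ QpCubeY i c (parSymY i) V) from (algebraMap_smul ℂ s _).symm] at h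
  refine hasMajorant_mono (g := toB6 (geoCK i c) Rr H) _ h fun a a' => le_of_eq ?_
  have hl := geoCK_len_pos i c a
  rw [Real.rpow_neg hl.le, show ((geoCK i c).len a) ^ (4 : ℝ) = (geoCK i c).len a ^ (4 : ℕ) by exact_mod_cast Real.rpow_natCast ((geoCK i c).len a) 4]
  ring

set_option maxHeartbeats 800000 in
/-- ★ **`X_□(Ṽ^{u⁻¹})` IS A UNIT... — the gauged-back direction used by FILE 7's `hXc □`**: (3.33)′ `X_□(V^{g})R(g) = R(g)X_□(V)` (r05 `XCubeY_cov`) and the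
invertibility of `R(g)` transport `IsUnit X_□(V)` (p21 `cinv_cube_at_locCfg` at `Ṽ_□`) to `IsUnit X_□(V^{u⁻¹})`.
[cite: Balaban1985BackgroundPropagators, (3.25) p.394, (3.31)–(3.33) pp.395–396, Thm 3.2 p.398, Cor. 3.6 p.408] -/
theorem isUnit_XCubeY_gauge (g : GaugeY 𝔸 i) {V : CfgY 𝔸 i} (hX : IsUnit (XCubeY i c (parSymY i) V)) :
    IsUnit (XCubeY i c (parSymY i) (gaugeY i g V)) := by
  have h : XCubeY i c (parSymY i) (gaugeY i g V) * conjY (gBlkCubeY i c g) = conjY (gBlkCubeY i c g) * XCubeY i c (parSymY i) V :=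
    XCubeY_cov c (g := g) (U := V) (parSymY_isGaugeLawS i)
  obtain ⟨w, hw⟩ := isUnit_conjY (gBlkCubeY i c g)
  rw [← hw] at h
  have h2 : IsUnit (XCubeY i c (parSymY i) (gaugeY i g V) * (w : Module.End ℂ (BlkCubeY i c → 𝔸))) := by rw [h]; exact w.isUnit.mul hX
  exact (Units.isUnit_mul_units _ w).mp h2

end Literature.MathematicalPhysics.QuantumFieldTheory.Balaban1983to89.B9Eq3105FamThreeLocCDiffCubeTailsGK.CubeData
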